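import Summits.BirchSwinnertonDyer.BirchSwinnertonDyer.Theorems.EisensteinPrimesSelmerAcQuotientCorankLeGeneric
import Summits.BirchSwinnertonDyer.BirchSwinnertonDyer.Theorems.EisensteinPrimesUnramifiedLeAwayKer
import Summits.BirchSwinnertonDyer.BirchSwinnertonDyer.Theorems.EisensteinPrimesNumPlacesAboveRepresentatives
import Summits.BirchSwinnertonDyer.BirchSwinnertonDyer.Theorems.EisensteinPrimesUnrSelmerQuotientTorsionFiniteChar
import Summits.BirchSwinnertonDyer.Rank1Residual.X2.LocalInertiaCohomologyMultiplicative
import Summits.BirchSwinnertonDyer.Rank1Residual.X2.LocalInertiaCohomologyAdditive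
import Summits.BirchSwinnertonDyer.Rank1Residual.X2.GreenbergVatsalTorsionCurve
import Literature.NumberTheory.EllipticCurves.ZpCorankQuasiIso
import HarnessLib

/-!
# `corank_{ℤ_p}(Sel_𝔭^{Sf}(K_∞, E[p^∞])/Sel_𝔭(K_∞, E[p^∞])) ≤ Σ_{w∈Sf} [Γ : Γ_w] · c_w` for Castella's
# anticyclotomic Selmer groups of an elliptic curve over an imaginary quadratic field, from ANY
# inertia-level per-place bounds `c_w` — and `c_w = 0` at ADDITIVE places (the `f`-side `≤`-half
# of `rem142_goodLattice_selmerAc_imprimitive`, assembled up to the multiplicative local input)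

Cell `bsd-eis` (home `run/shared/lean/pub/bsd-eis/`), seat `bsd-line-x1-p1-w2` (D-0154 width seat on
crux 2 `GoodLatticeBDPValue` = stmt-BirchSwinnertonDyer-19032, line `halves` v14, stub
`stub_imprimCorank`, `f`-SIDE conjunct `KellerYin2024.rem142_goodLattice_selmerAc_imprimitive`:
`zpCorank (Sel_v̄^{Sf}/Sel_v̄^∅)(E[p^∞]/K_∞) = Σ_{w∈Sf} curveLocalLambda κ (E/K) w`, with
`curveLocalLambda = numPlacesAbove κ w · rootMultiplicity((Nw)⁻¹, P̃_w)`), files F3a/F4-generic of the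
unconditional `≤`-half (planner RULING L108 (b): helper files only).

* §1 **`zpCorank_selmerAc_quotient_le_sum_of_loc`** — for `K` imaginary quadratic, `2 < p`, (Heeg) for
  `N`, `p ∤ N`, `κ` anticyclotomic with a topological generator, ANY elliptic `W/K` (e.g. the base
  change of `E/ℚ`), any `𝔭`, `Sf` = the primes of `K` over `N`, and ANY `c : place → ℕ` bounding the
  corank formula of the subgroups of the image of `r_w : H¹(K_∞, E[p^∞]) → H¹(I_w(K_∞), E[p^∞])`
  (`hloc`): `zpCorank (Sel_𝔭^{Sf}/Sel_𝔭^∅) p ≤ Σ_{w∈Sf} numPlacesAbove κ w · c w`. Assembly of F1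
  (p610683, the generic bound for Castella's groups), F2 (`…UnramifiedLeAwayKer`: unramified ⇒ locally
  trivial at the finitely decomposed `w ∈ Sf`), the sharp place count p607080, and Brink's finite
  decomposition of split primes (`exists_mem_decomp_apply_ne_one_of_heegner`).
* §2 **`zpCorank_eq_zero_of_hasAdditiveReductionAt`** — at an ADDITIVE `w ∤ p` with `I_w ≤ H`, every
  subgroup of `H¹(H ∩ I_w, E[p^∞])` has `zpCorank = 0` (it is finite: b2b X2
  `finite_discreteH1_inertiaIn_of_hasAdditiveReductionAt`, Kodaira–Néron exponent), i.e. `c_w = 0`,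
  matching `rootMultiplicity((Nw)⁻¹, P̃_w = 1) = 0`.
What remains for the `f`-side `≤` (F3b/F4): `c_w ≤ rootMultiplicity((Nw)⁻¹, 1 − ā_w X)` at the
MULTIPLICATIVE `w ∈ Sf` (b2b X2 `LocalInertiaCohomologyMultiplicative[Vanishing]` at `W.baseChange K`
with the Tate data of `Silverman1994_thmV53_tateUniformisation`, stated for any number field), and
the identification of `GreenbergVatsal2000.eulerFactorModP (E/K) p w` at the split bad `w`.

HONEST FRAMING: tool theorems only (no definition, no named fact, no `sorry`); closes nothing by itself
(`--supports stmt-BirchSwinnertonDyer-19032`); BSD / Mazur's main conjecture is proved for no curve.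

References: Castella 2018 Def. 2.2; Castella–Grossi–Lee–Skinner 2022 proof of Thm. 1.5.1 (L893–931);
Keller–Yin arXiv:2402.12781v2 Rem. 1.4.2, §1.5 (L1337–1341); Greenberg–Vatsal 2000 §2 Prop. (2.4);
Brink 2007 Thm. 2; Silverman AEC VII.6.1.
-/

-- `Summit.BirchSwinnertonDyer.BirchSwinnertonDyer.…`: summit and sub-problem share a name (D-0017 layout).
set_option linter.dupNamespace false
set_option autoImplicit false

noncomputable section

open scoped Classical AddSubgroup

open WeierstrassCurve NumberField IsDedekindDomain Field
  Literature.NumberTheory.EllipticCurves Literature.NumberTheory.QuadraticFields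
  Literature.NumberTheory.EllipticCurves.Rank1Residual
  Literature.NumberTheory.EllipticCurves.Castella2018 Literature.NumberTheory.EllipticCurves.GreenbergSelmer
  Literature.NumberTheory.EllipticCurves.GreenbergVatsal2000 Literature.NumberTheory.GaloisRepresentations
  Literature.NumberTheory.EllipticCurves.KellerYin2024
  Summit.BirchSwinnertonDyer.Rank1Residual Summit.BirchSwinnertonDyer.BirchSwinnertonDyer.Theorems

namespace Summit.BirchSwinnertonDyer.BirchSwinnertonDyer.Theorems.SelmerAcQuotientCorankOfLoc

/-! ## §1 The quotient bound for `Sel_𝔭^{Sf}(K_∞, E[p^∞])/Sel_𝔭` from any inertia-level local bounds -/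

section OfLoc

variable {K : Type} [Field K] [NumberField K] {p : ℕ} [hp : Fact p.Prime]

/-- **`zpCorank (Sel_𝔭^{Sf}(K_∞, E[p^∞]) / Sel_𝔭(K_∞, E[p^∞])) p ≤ Σ_{w∈Sf} [Γ : Γ_w] · c_w`** for
Castella's anticyclotomic Selmer groups (`AcSelmer.selmerAc W p κ 𝔭`), `K` imaginary quadratic, `2 < p`,
(Heeg) for `N` with `p ∤ N`, `κ` anticyclotomic with topological generator `γ`, ANY elliptic `W/K`,
any `𝔭`, `Sf` = the primes of `K` over `N` (split over `ℚ`, `∤ p`, finitely decomposed in `K_∞`),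
granted per-place bounds `c_w` on the corank formula of the subgroups of the image of the INERTIA
restriction `r_w : H¹(K_∞, E[p^∞]) → H¹(I_w(K_∞), E[p^∞])` (`hloc`). F1 (p610683) with `hUT`
discharged by F2 at the finitely decomposed `w ∈ Sf`, `hrep` the sharp count (p607080), and the
module facts of `E[p^∞]` (`p`-primary, `p`-divisible, `#E[p] = p²`, open stabilisers). The `f`-side
twin of the LEAD's `UnrSelmerQuotientCorankChar.…_of_loc` for the character side.
[cite: CastellaGrossiLeeSkinner2022, proof of Thm. 1.5.1 (arXiv:2008.02571v2 TeX L909–931)]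
[cite: Castella2018, Def. 2.2 (arXiv:1704.06608 p. 5)] [cite: Brink2007, Thm. 2] -/
theorem zpCorank_selmerAc_quotient_le_sum_of_loc (hK : IsImaginaryQuadratic K) (hp2 : 2 < p)
    {N : ℕ} (hH : SatisfiesHeegnerHypothesis N K) (hpN : ¬ p ∣ N) (κ : ZpExtension K p)
    (hκ : κ.IsAnticyclotomic) {γ : absoluteGaloisGroup K} (hγ : κ.IsTopGenerator γ)
    (W : WeierstrassCurve K) [W.IsElliptic] (𝔭 : HeightOneSpectrum (𝓞 K))
    (Sf : Finset (HeightOneSpectrum (𝓞 K)))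
    (hSf : ∀ w : HeightOneSpectrum (𝓞 K), w ∈ Sf ↔ ((N : ℤ) : 𝓞 K) ∈ w.asIdeal)
    (c : HeightOneSpectrum (𝓞 K) → ℕ)
    (hloc : ∀ w ∈ Sf, ∀ Y : AddSubgroup (discreteH1 (inertiaIn κ.kerSubgroup w) (W.geomPrimaryTorsion p)),
      (∀ y ∈ Y, ∃ x : subgroupH1 κ.kerSubgroup (W.geomPrimaryTorsion p),
        resH1Hom (inertiaInToH κ.kerSubgroup w) (AddMonoidHom.id (W.geomPrimaryTorsion p))
          (fun _ _ ↦ rfl) x = y) →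
      zpCorank Y p ≤ c w) :
    zpCorank (↥(AcSelmer.selmerAc W p κ 𝔭 (↑Sf : Set (HeightOneSpectrum (𝓞 K)))) ⧸
      (AcSelmer.selmerAc W p κ 𝔭 (∅ : Set (HeightOneSpectrum (𝓞 K)))).addSubgroupOf
        (AcSelmer.selmerAc W p κ 𝔭 (↑Sf : Set (HeightOneSpectrum (𝓞 K))))) p ≤
      ∑ w ∈ Sf, numPlacesAbove κ w * c w := by
  -- module facts of `M = E[p^∞]`
  have htor : ∀ m : W.geomPrimaryTorsion p, ∃ k : ℕ, p ^ k • m = 0 :=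
    X2.LocalInertiaCohomologyMultiplicative.primary_curve W p
  have hdiv : ∀ m : W.geomPrimaryTorsion p, ∃ m' : W.geomPrimaryTorsion p, p • m' = m :=
    X2.GreenbergVatsalTorsionCurve.divisible_curve W p
  have hstab : ∀ m : W.geomPrimaryTorsion p,
      IsOpen (MulAction.stabilizer (absoluteGaloisGroup K) m : Set (absoluteGaloisGroup K)) :=
    fun m ↦ X11b.LocBridge.isOpen_stabilizer_geomPrimaryTorsion W p m
  haveI : Finite ↥((W.geomPrimaryTorsion p)[(p : ℤ)]) :=
    X2.LocalInertiaCohomologyMultiplicative.finite_torsionBy_curve W p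
  have hcard : ∃ k : ℕ, Nat.card ↥((W.geomPrimaryTorsion p)[(p : ℤ)]) = p ^ k :=
    ⟨2, X2.LocalInertiaCohomologyMultiplicative.natCard_torsionBy_curve W p⟩
  -- the places over `N`: `∤ p`, finitely decomposed, unramified in `K_∞`
  have hSfp : ∀ w ∈ Sf, ((p : ℕ) : 𝓞 K) ∉ w.asIdeal := by
    intro w hw hpw
    have hw : ((N : ℕ) : 𝓞 K) ∈ w.asIdeal := by exact_mod_cast (hSf w).mp hw
    have hcop : IsCoprime (N : ℤ) (p : ℤ) :=
      Nat.isCoprime_iff_coprime.mpr (Nat.Coprime.symm ((Nat.Prime.coprime_iff_not_dvd hp.out).mpr hpN))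
    obtain ⟨a, b, hab⟩ := hcop
    have h1 : (1 : 𝓞 K) ∈ w.asIdeal := by
      have e := congrArg (fun z : ℤ ↦ (z : 𝓞 K)) hab
      push_cast at e
      rw [← e]
      exact w.asIdeal.add_mem (w.asIdeal.mul_mem_left _ hw) (w.asIdeal.mul_mem_left _ hpw)
    exact w.isPrime.ne_top ((Ideal.eq_top_iff_one _).mpr h1)
  have hD : ∀ w ∈ Sf, ∃ δ ∈ decomp (K := K) w, κ δ ≠ 1 := fun w hw ↦
    UnrSelmerQuotientTorsionFiniteChar.exists_mem_decomp_apply_ne_one_of_heegner hK hp2 hH κ hκ w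
      ((hSf w).mp hw) (hSfp w hw)
  have hUT : ∀ w ∈ Sf, unramifiedKer κ.kerSubgroup (W.geomPrimaryTorsion p) w ≤
      awayKer κ.kerSubgroup (W.geomPrimaryTorsion p) w := by
    intro w hw
    obtain ⟨δ, hδ, hne⟩ := hD w hw
    exact UnramifiedLeAwayKer.unramifiedKer_le_awayKer_of_not_decomp_le κ hstab htor
      (Iwasawa.inertia_le_kerSubgroup' κ w (hSfp w hw))
      (fun hle ↦ hne (ZpExtension.mem_kerSubgroup.mp (hle hδ)))
  exact SelmerAcQuotientCorankLeGeneric.zpCorank_selmerOver_quotient_le_sum κ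
    (M := W.geomPrimaryTorsion p) htor hcard hdiv hstab 𝔭 Sf hSfp (fun w ↦ numPlacesAbove κ w) c
    (fun w hw σ ↦ NumPlacesAboveRepresentatives.forall_exists_lt_numPlacesAbove κ w hγ (hD w hw) σ)
    hloc hUT

end OfLoc

/-! ## §2 Additive places contribute nothing: `c_w = 0` -/

section Additive

variable {K : Type} [Field K] [NumberField K] {p : ℕ} [hp : Fact p.Prime]

/-- **At an ADDITIVE place `w ∤ p` every subgroup of `H¹(H ∩ I_w, E[p^∞])` has `ℤ_p`-corank `0`**
(for `I_w ≤ H`): the group is FINITE (b2b X2 `finite_discreteH1_inertiaIn_of_hasAdditiveReductionAt`: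
an inertia-fixed `p`-power torsion point is killed by a Kodaira–Néron exponent `c ≤ 4`), and a finite
group has `zpCorank = 0`. The `f`-side per-place bound `c_w = 0 = rootMultiplicity((Nw)⁻¹, P̃_w = 1)`
of KY §1.5 / GV Prop. (2.4) at additive `w`. [cite: GreenbergVatsal2000, §2 Prop. (2.4) p. 22]
[cite: SilvermanAEC2009, Thm. VII.6.1] -/
theorem zpCorank_eq_zero_of_hasAdditiveReductionAt (W : WeierstrassCurve K) [W.IsElliptic]
    (H : Subgroup (absoluteGaloisGroup K)) (w : HeightOneSpectrum (𝓞 K))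
    (hpw : ((p : ℕ) : 𝓞 K) ∉ w.asIdeal) (hadd : W.HasAdditiveReductionAt w)
    (hIH : inertia (K := K) w ≤ H) (Y : AddSubgroup (discreteH1 (inertiaIn H w) (W.geomPrimaryTorsion p))) :
    zpCorank Y p = 0 := by
  haveI := X2.LocalInertiaCohomologyAdditive.finite_discreteH1_inertiaIn_of_hasAdditiveReductionAt W p H w
    hpw hadd hIH
  haveI : Finite Y := Subtype.finite
  exact zpCorank_of_finite_eq_zero p

end Additive

end Summit.BirchSwinnertonDyer.BirchSwinnertonDyer.Theorems.SelmerAcQuotientCorankOfLoc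

end
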